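import Literature.NumberTheory.Rogawski1990.ArchEllipticOrbitHSBallThree      -- ★ p849073 (B′): `hs_le_of_hs_conj_compactTorusRep₃_le`, `archThree_inv_eq`
import Literature.NumberTheory.Rogawski1990.ArchUnitaryThreeEigenframeCompact   -- ★ p848127: `compactTorusRep₃_mul ∕ _one`, `conjTranspose_compactTorusRep₃_mul`; via its imports ★ `isCompact_setOf_norm_apply_le_and_inv`, ★ `sub_one_mul_frameGram_apply_eq_zero`, ★ `exists_conj_eq_diagonal_of_nodup_roots'`
import HarnessLib

/-!
# The regular elliptic classes of `U(2,1) = U(Φ₃)(ℂ)`: rational normal form `h · M(u₀,u₁,u₂) · h⁻¹` and compact centralisers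
# ((α″) + (Z′) of the LH2 (VOL)-kit; Rogawski 1990 §3.6, Knapp 1986 Ch. V §3)

Topic `NumberTheory/Rogawski1990`; namespace `Literature.NumberTheory.Rogawski1990`.  THEOREMS ONLY (no definition, no instance, no notation, no axiom, no named fact,
no `sorry`).  Cell `pub/hodgecm-mathlib`, crux H413 (`stmt-HodgeConjecture-24833`), F0∕P3c line LH2 (closer stub `stub_N8`; letters O1″∕O3″ on `G_∞ = U(Φ₃)(L⁺ ⊗ ℝ) ≅ U(2,1)^d`);
seat LH2-p01 (g3), bricks (Z′)+(α″) (LH2-plan (g0) «GO» 2026-09-02T04:19:39Z); lane `--supports stmt-HodgeConjecture-24833`.  COUNT-NEUTRAL kit: the two algebraic inputs that let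
the elliptic orbit-volume brick (E′) (LH2-p02) and the per-place token `hplace` of (Π′-G) (LH2-p03) be APPLIED at an actual regular elliptic class of `U(2,1)`.

NOTATION (spelled out in the statements, no `def`): `Φ₃ = antidiag(1,1,1) = Matrix.of (i+j+1 = 3)`; `U(Φ₃)(ℂ) = unitaryGroupOfForm (starRingEnd ℂ) Φ₃ ≤ GL₃(ℂ)`; the block
representative of the compact Cartan `M(u₀,u₁,u₂) = ½(u₀+u₂, 0, u₀−u₂; 0, 2u₁, 0; u₀−u₂, 0, u₀+u₂) = T₀ · diag(u₀,u₁,u₂) · T₀` with the real orthogonal involution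
`T₀ = 2^{-1∕2}(1,0,1; 0,√2,0; 1,0,−1)` (`T₀ᴴ Φ₃ T₀ = diag(1,1,−1)`), as in ★ `ArchUnitaryThreeEigenframeCompact` §2 and ★ `ArchEllipticOrbitHSBallThree`.

* §1 (Z′) **compact centralisers.**  In any CLOSED subgroup `Γ ≤ GL₃(ℂ)` of `Φ₃`-unitary matrices (`Γ = U(Φ₃)(ℂ)`, `isClosed_unitaryGroupOfForm_antidiag_three`; or a place
  carrier): if `γ ∈ Γ` has matrix `M(u₀,u₁,u₂)` with `|uᵢ| = 1` and `u₂ ∉ {u₀, u₁}`, then `Z_Γ(γ) = Subgroup.centralizer {γ}` is COMPACT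
  (`isCompact_centralizer_of_coe_eq_compactTorusRep₃`, `compactSpace_centralizer_of_coe_eq_compactTorusRep₃`), and so is the centraliser of every conjugate `h γ h⁻¹`
  (`isCompact_centralizer_conj`, `compactSpace_centralizer_of_eq_conj_compactTorusRep₃`).  PROOF FOR FREE from (B′): for `y ∈ Z(γ)`, `y γ y⁻¹ = γ`, so ★
  `hs_le_of_hs_conj_compactTorusRep₃_le` at `R := Σ|M_{ab}|²` bounds `Σ|y_{ab}|²`, and `Σ|(y⁻¹)_{ab}|² = Σ|y_{ab}|²` (`y⁻¹ = Φ₃ yᴴ Φ₃`, ★ `archThree_inv_eq`); a closed set of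
  units with bounded entries and bounded inverse entries is compact (★ `isCompact_setOf_norm_apply_le_and_inv`).  These discharge the `[CompactSpace ↥Z(γ)]` binder of
  ★ `quotientMeasure_setOf_le_of_compact_of_group_bound` ∕ (E′) by `haveI`.
* §2 (α″) **rational normal form.**  If `g ∈ U(Φ₃)(ℂ)` has separable characteristic polynomial all of whose roots are UNIMODULAR (regular ELLIPTIC), then
  `g = h · γ · h⁻¹` INSIDE `U(Φ₃)(ℂ)` with `γ` of matrix `M(u₀,u₁,u₂)`, `uᵢ` unimodular and pairwise distinct (`exists_conj_eq_compactTorusRep₃_of_separable_of_norm_root_eq_one`).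
  This is RATIONAL conjugacy (inside `U(2,1)`), not the STABLE (`GL₃(ℂ)`-) conjugacy of ★ `exists_isCompact_forall_isConj_of_mem_unitaryGroupOfForm_antidiag_three`: the stable
  class of a regular elliptic element meets `T_c` in several `U(2,1)`-classes ([Rogawski1990, §3.6]); the proof decides which eigenvalue sits on the NEGATIVE line.  Road:
  diagonalise `g S = S diag(d)` (★ Horn–Johnson 1.3.9); the Gram matrix `Q = Sᴴ Φ₃ S` is diagonal (eigenvectors for `d̄ᵢ dⱼ ≠ 1` are `Φ₃`-orthogonal, ★
  `sub_one_mul_frameGram_apply_eq_zero`; `d̄ᵢ dⱼ = 1 ⇔ i = j` by unimodularity and distinctness) and Hermitian, `Q = diag(q)`, `q ∈ ℝ³`; `det Q = −|det S|² < 0` and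
  `1 = (Φ₃)₁₁ = ((S⁻¹)ᴴ Q S⁻¹)₁₁ = Σ qᵢ |(S⁻¹)ᵢ₁|²` forbid «all `qᵢ < 0`», so EXACTLY ONE `q_c < 0` (signature `(2,1)`); renormalising the frame (`|qᵢ|^{-1∕2}`, the negative
  column last) gives `S′` with `S′ᴴ Φ₃ S′ = diag(1,1,−1)` and `g S′ = S′ diag(u)`, and `h := S′ T₀ ∈ U(Φ₃)(ℂ)` conjugates `M(u) = T₀ diag(u) T₀` to `g`.
  Corollary `compactSpace_centralizer_of_separable_of_norm_root_eq_one` = (Z′) ∘ (α″) at an actual regular elliptic `g`.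
  WHY `hunit` IS A HYPOTHESIS («unimodularity is NOT automatic for distinct eigenvalues»): the regular elements `diag(λ, u, λ̄⁻¹)`, `|λ| ≠ 1`, of the non-compact Cartan
  `T_s ≅ ℂˣ × U(1)` of `U(Φ₃)(ℂ)` have three distinct eigenvalues, two of them non-unimodular ([Rogawski1990, §3.6 p. 31], type (0)); they are not conjugate into `T_c`.
HONEST LABEL: HC_CM is proved only modulo the 7 printed citations (2 remaining: hLiu418 = `stmt-HodgeConjecture-24832`, h413 = `stmt-HodgeConjecture-24833`) until rung 0 closes;
this file is linear algebra under the LH2 letters and pays no printed row.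

## References
* [Rogawski1990] J. D. Rogawski, *Automorphic Representations of Unitary Groups in Three Variables*, Ann. of Math. Stud. 123 (1990), §3.6 p. 31 (the Cartan subgroups of `U(2,1)`,
  types (0) and (1)), §3.1 p. 19 (stable conjugacy), §1.9 p. 8 (`U_Φ`).
* [Knapp1986] A. W. Knapp, *Representation Theory of Semisimple Groups*, PMS 36 (1986), Ch. V §3 (compact Cartan subgroups; regular elliptic elements have compact centraliser).
* [HornJohnson2013] R. A. Horn, C. R. Johnson, *Matrix Analysis*, 2nd ed. (2013), Thm. 1.3.9 (distinct eigenvalues ⇒ diagonalisable), Thm. 4.5.8 (Sylvester's law of inertia).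
-/

set_option autoImplicit false

noncomputable section

open Matrix
open Literature.NumberTheory.Automorphic
open scoped MatrixGroups ComplexConjugate

namespace Literature.NumberTheory.Rogawski1990

/-! ## §1 (Z′) Compact centralisers of the regular elliptic representatives `M(u₀,u₁,u₂)` and of their conjugates -/

section CompactCentraliser

/-- One squared entry is at most the Hilbert–Schmidt sum. [folklore] -/
private theorem sq_norm_apply_le_hs₃ (M : Matrix (Fin 3) (Fin 3) ℂ) (a b : Fin 3) :
    ‖M a b‖ ^ 2 ≤ ∑ i : Fin 3, ∑ j : Fin 3, ‖M i j‖ ^ 2 := by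
  calc ‖M a b‖ ^ 2 ≤ ∑ j : Fin 3, ‖M a j‖ ^ 2 :=
        Finset.single_le_sum (f := fun j => ‖M a j‖ ^ 2) (fun j _ => by positivity) (Finset.mem_univ b)
    _ ≤ ∑ i : Fin 3, ∑ j : Fin 3, ‖M i j‖ ^ 2 :=
        Finset.single_le_sum (f := fun i => ∑ j : Fin 3, ‖M i j‖ ^ 2) (fun i _ => by positivity) (Finset.mem_univ a)

/-- `|M_{ab}| ≤ √(Σ|M_{ij}|²)`. [folklore] -/
private theorem norm_apply_le_sqrt_hs₃ (M : Matrix (Fin 3) (Fin 3) ℂ) (a b : Fin 3) :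
    ‖M a b‖ ≤ Real.sqrt (∑ i : Fin 3, ∑ j : Fin 3, ‖M i j‖ ^ 2) := by
  have h := Real.abs_le_sqrt (sq_norm_apply_le_hs₃ M a b)
  rwa [abs_of_nonneg (norm_nonneg _)] at h

/-- **`Σ|(y⁻¹)_{ab}|² = Σ|y_{ab}|²` for `y ∈ U(Φ₃)(ℂ)`**: `y⁻¹ = Φ₃ yᴴ Φ₃` (★ `archThree_inv_eq`) has the entries of `y` conjugated and reflected.
[cite: Rogawski1990, §1.9 p. 8] -/
theorem hs_inv_eq_hs_of_archThree {y : Matrix (Fin 3) (Fin 3) ℂ}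
    (hy : (y.map (starRingEnd ℂ))ᵀ * (Matrix.of fun i j : Fin 3 => if i.val + j.val + 1 = 3 then (1 : ℂ) else 0) * y =
      (Matrix.of fun i j : Fin 3 => if i.val + j.val + 1 = 3 then (1 : ℂ) else 0)) :
    ∑ i : Fin 3, ∑ j : Fin 3, ‖y⁻¹ i j‖ ^ 2 = ∑ i : Fin 3, ∑ j : Fin 3, ‖y i j‖ ^ 2 := by
  rw [archThree_inv_eq hy]
  simp only [Fin.sum_univ_three, Matrix.mul_apply, Matrix.of_apply, Matrix.conjTranspose_apply]
  simp
  ring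

/-- **`U(Φ₃)(ℂ)` is closed in `GL₃(ℂ)`** (the defining equation is continuous). [cite: Rogawski1990, §1.9 p. 8] -/
theorem isClosed_unitaryGroupOfForm_antidiag_three :
    IsClosed (unitaryGroupOfForm (starRingEnd ℂ) (Matrix.of fun i j : Fin 3 => if i.val + j.val + 1 = 3 then (1 : ℂ) else 0) : Set (GL (Fin 3) ℂ)) := by
  have h1 : Continuous fun g : GL (Fin 3) ℂ => (g : Matrix (Fin 3) (Fin 3) ℂ) := Units.continuous_val
  exact isClosed_eq (((h1.matrix_map Complex.continuous_conj).matrix_transpose.mul continuous_const).mul h1) continuous_const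

/-- **(Z′) COMPACT CENTRALISER of the regular elliptic representative**, in ANY closed subgroup `Γ ≤ GL₃(ℂ)` of `Φ₃`-unitary matrices (`Γ = U(Φ₃)(ℂ)` itself, or a
place carrier `archLocal L 3 Φ₃ w`).  If `γ ∈ Γ` has matrix `M(u₀,u₁,u₂)` with `|uᵢ| = 1` and `u₂ ∉ {u₀, u₁}`, then `Z_Γ(γ) = Subgroup.centralizer {γ} ≤ Γ` is compact: for
`y ∈ Z_Γ(γ)`, `y γ y⁻¹ = γ` and ★ `hs_le_of_hs_conj_compactTorusRep₃_le` bounds `Σ|y_{ab}|²` (hence every entry of `y` and of `y⁻¹`) by a constant.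
[cite: Knapp1986, Ch. V §3] [cite: Rogawski1990, §3.6 p. 31] -/
theorem isCompact_centralizer_of_coe_eq_compactTorusRep₃ {Γ : Subgroup (GL (Fin 3) ℂ)}
    (hΓ : Γ ≤ unitaryGroupOfForm (starRingEnd ℂ) (Matrix.of fun i j : Fin 3 => if i.val + j.val + 1 = 3 then (1 : ℂ) else 0))
    (hΓc : IsClosed (Γ : Set (GL (Fin 3) ℂ))) {γ : ↥Γ}
    {u₀ u₁ u₂ : ℂ} (h₀ : ‖u₀‖ = 1) (h₁ : ‖u₁‖ = 1) (h₂ : ‖u₂‖ = 1) (h₀₂ : u₀ ≠ u₂) (h₁₂ : u₁ ≠ u₂)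
    (hγ : ((γ : GL (Fin 3) ℂ) : Matrix (Fin 3) (Fin 3) ℂ) = !![(u₀ + u₂) / 2, 0, (u₀ - u₂) / 2; 0, u₁, 0; (u₀ - u₂) / 2, 0, (u₀ + u₂) / 2]) :
    IsCompact ((Subgroup.centralizer ({γ} : Set ↥Γ)) : Set ↥Γ) := by
  -- the radius
  set R₀ : ℝ := ∑ a : Fin 3, ∑ b : Fin 3, ‖(!![(u₀ + u₂) / 2, 0, (u₀ - u₂) / 2; 0, u₁, 0; (u₀ - u₂) / 2, 0, (u₀ + u₂) / 2] : Matrix (Fin 3) (Fin 3) ℂ) a b‖ ^ 2 with hR₀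
  set B : ℝ := Real.sqrt (3 * Real.sqrt (1 + 4 * R₀ / (min (‖u₀ - u₂‖ ^ 2) (‖u₁ - u₂‖ ^ 2)) ^ 2)) with hB
  -- `Γ` is closed in `GL₃(ℂ)`, so the inclusion is a closed embedding
  have hemb : Topology.IsClosedEmbedding (Subtype.val : ↥Γ → GL (Fin 3) ℂ) := hΓc.isClosedEmbedding_subtypeVal
  -- the compact box of units and its (compact) preimage
  have hK := hemb.isCompact_preimage (isCompact_setOf_norm_apply_le_and_inv 3 B)
  -- the centraliser is closed
  have hZc : IsClosed ((Subgroup.centralizer ({γ} : Set ↥Γ)) : Set ↥Γ) := by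
    have e : ((Subgroup.centralizer ({γ} : Set ↥Γ)) : Set ↥Γ) = {y | y * γ = γ * y} := by
      ext y
      exact Subgroup.mem_centralizer_singleton_iff
    rw [e]
    exact isClosed_eq (continuous_id.mul continuous_const) (continuous_const.mul continuous_id)
  -- the centraliser lies in the box
  refine hK.of_isClosed_subset hZc fun y hy => ?_
  have hyγ : y * γ * y⁻¹ = γ := by
    have h := Subgroup.mem_centralizer_singleton_iff.1 hy
    rw [mul_inv_eq_iff_eq_mul, h]
  have hmat : ((y : GL (Fin 3) ℂ) : Matrix (Fin 3) (Fin 3) ℂ) * !![(u₀ + u₂) / 2, 0, (u₀ - u₂) / 2; 0, u₁, 0; (u₀ - u₂) / 2, 0, (u₀ + u₂) / 2] *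
      (((y : GL (Fin 3) ℂ) : Matrix (Fin 3) (Fin 3) ℂ))⁻¹ = !![(u₀ + u₂) / 2, 0, (u₀ - u₂) / 2; 0, u₁, 0; (u₀ - u₂) / 2, 0, (u₀ + u₂) / 2] := by
    have h := congrArg (fun z : ↥Γ => (((z : GL (Fin 3) ℂ)) : Matrix (Fin 3) (Fin 3) ℂ)) hyγ
    simp only [Subgroup.coe_mul, Subgroup.coe_inv, Units.val_mul, Matrix.coe_units_inv, hγ] at h
    exact h
  have hy' : ((((y : GL (Fin 3) ℂ) : Matrix (Fin 3) (Fin 3) ℂ)).map (starRingEnd ℂ))ᵀ * (Matrix.of fun i j : Fin 3 => if i.val + j.val + 1 = 3 then (1 : ℂ) else 0) *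
      ((y : GL (Fin 3) ℂ) : Matrix (Fin 3) (Fin 3) ℂ) = (Matrix.of fun i j : Fin 3 => if i.val + j.val + 1 = 3 then (1 : ℂ) else 0) := hΓ y.2
  have hHS : ∑ a : Fin 3, ∑ b : Fin 3, ‖((y : GL (Fin 3) ℂ) : Matrix (Fin 3) (Fin 3) ℂ) a b‖ ^ 2 ≤
      3 * Real.sqrt (1 + 4 * R₀ / (min (‖u₀ - u₂‖ ^ 2) (‖u₁ - u₂‖ ^ 2)) ^ 2) :=
    hs_le_of_hs_conj_compactTorusRep₃_le hy' h₀ h₁ h₂ h₀₂ h₁₂ (le_of_eq (by rw [hmat]))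
  refine fun i j => ⟨?_, ?_⟩
  · exact (norm_apply_le_sqrt_hs₃ _ i j).trans (Real.sqrt_le_sqrt hHS)
  · rw [Matrix.coe_units_inv]
    refine (norm_apply_le_sqrt_hs₃ _ i j).trans (Real.sqrt_le_sqrt ?_)
    rw [hs_inv_eq_hs_of_archThree hy']
    exact hHS

/-- (Z′) as the `CompactSpace` token of ★ `quotientMeasure_setOf_le_of_compact_of_group_bound` ∕ ★ (E′) `quotientMeasure_setOf_hs_conj_le_of_quadratic_growth` (binder
`[CompactSpace ↥(Subgroup.centralizer ({γ} : Set Γ))]`, any closed `Γ ≤ U(Φ₃)(ℂ)`; a THEOREM, never an instance: use `haveI := …`). [cite: Knapp1986, Ch. V §3] -/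
theorem compactSpace_centralizer_of_coe_eq_compactTorusRep₃ {Γ : Subgroup (GL (Fin 3) ℂ)}
    (hΓ : Γ ≤ unitaryGroupOfForm (starRingEnd ℂ) (Matrix.of fun i j : Fin 3 => if i.val + j.val + 1 = 3 then (1 : ℂ) else 0))
    (hΓc : IsClosed (Γ : Set (GL (Fin 3) ℂ))) {γ : ↥Γ}
    {u₀ u₁ u₂ : ℂ} (h₀ : ‖u₀‖ = 1) (h₁ : ‖u₁‖ = 1) (h₂ : ‖u₂‖ = 1) (h₀₂ : u₀ ≠ u₂) (h₁₂ : u₁ ≠ u₂)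
    (hγ : ((γ : GL (Fin 3) ℂ) : Matrix (Fin 3) (Fin 3) ℂ) = !![(u₀ + u₂) / 2, 0, (u₀ - u₂) / 2; 0, u₁, 0; (u₀ - u₂) / 2, 0, (u₀ + u₂) / 2]) :
    CompactSpace ↥(Subgroup.centralizer ({γ} : Set ↥Γ)) :=
  isCompact_iff_compactSpace.1 (isCompact_centralizer_of_coe_eq_compactTorusRep₃ hΓ hΓc h₀ h₁ h₂ h₀₂ h₁₂ hγ)

/-- **Centralisers of conjugates**: in any topological group, `Z(h γ h⁻¹) = h Z(γ) h⁻¹` is compact when `Z(γ)` is. [folklore] [cite: Knapp1986, Ch. V §3] -/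
theorem isCompact_centralizer_conj {G : Type*} [Group G] [TopologicalSpace G] [IsTopologicalGroup G] {γ : G}
    (hZ : IsCompact ((Subgroup.centralizer ({γ} : Set G)) : Set G)) (h : G) :
    IsCompact ((Subgroup.centralizer ({h * γ * h⁻¹} : Set G)) : Set G) := by
  have e : ((Subgroup.centralizer ({h * γ * h⁻¹} : Set G)) : Set G) = (fun y => h * y * h⁻¹) '' ((Subgroup.centralizer ({γ} : Set G)) : Set G) := by
    ext y
    simp only [SetLike.mem_coe, Set.mem_image, Subgroup.mem_centralizer_singleton_iff]
    constructor
    · intro hy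
      refine ⟨h⁻¹ * y * h, ?_, by group⟩
      calc h⁻¹ * y * h * γ = h⁻¹ * (y * (h * γ * h⁻¹)) * h := by group
        _ = h⁻¹ * ((h * γ * h⁻¹) * y) * h := by rw [hy]
        _ = γ * (h⁻¹ * y * h) := by group
    · rintro ⟨z, hz, rfl⟩
      calc h * z * h⁻¹ * (h * γ * h⁻¹) = h * (z * γ) * h⁻¹ := by group
        _ = h * (γ * z) * h⁻¹ := by rw [hz]
        _ = h * γ * h⁻¹ * (h * z * h⁻¹) := by group
  rw [e]
  exact hZ.image ((continuous_const.mul continuous_id).mul continuous_const)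

/-- **(Z′) for every class conjugate to the representative**: if `γ₀ = h γ h⁻¹` in a closed `Γ ≤ U(Φ₃)(ℂ)` with `γ` of matrix `M(u₀,u₁,u₂)` (`|uᵢ| = 1`, `u₂ ∉ {u₀,u₁}`), then
`Z_Γ(γ₀)` is a compact space (the token consumed by (E′)'s transport theorem and by ★ `quotientMeasure_setOf_le_of_compact_of_group_bound`).
[cite: Knapp1986, Ch. V §3] [cite: Rogawski1990, §3.6 p. 31] -/
theorem compactSpace_centralizer_of_eq_conj_compactTorusRep₃ {Γ : Subgroup (GL (Fin 3) ℂ)}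
    (hΓ : Γ ≤ unitaryGroupOfForm (starRingEnd ℂ) (Matrix.of fun i j : Fin 3 => if i.val + j.val + 1 = 3 then (1 : ℂ) else 0))
    (hΓc : IsClosed (Γ : Set (GL (Fin 3) ℂ))) {γ γ₀ h : ↥Γ}
    {u₀ u₁ u₂ : ℂ} (h₀ : ‖u₀‖ = 1) (h₁ : ‖u₁‖ = 1) (h₂ : ‖u₂‖ = 1) (h₀₂ : u₀ ≠ u₂) (h₁₂ : u₁ ≠ u₂)
    (hγ : ((γ : GL (Fin 3) ℂ) : Matrix (Fin 3) (Fin 3) ℂ) = !![(u₀ + u₂) / 2, 0, (u₀ - u₂) / 2; 0, u₁, 0; (u₀ - u₂) / 2, 0, (u₀ + u₂) / 2])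
    (hconj : γ₀ = h * γ * h⁻¹) :
    CompactSpace ↥(Subgroup.centralizer ({γ₀} : Set ↥Γ)) := by
  rw [hconj]
  exact isCompact_iff_compactSpace.1 (isCompact_centralizer_conj (isCompact_centralizer_of_coe_eq_compactTorusRep₃ hΓ hΓc h₀ h₁ h₂ h₀₂ h₁₂ hγ) h)

end CompactCentraliser

/-! ## §2 (α″) The rational normal form of a regular elliptic element of `U(Φ₃)(ℂ)` -/

section NormalForm

/-- `Φ₃` as a matrix literal. [cite: Rogawski1990, §1.9 p. 8] -/
private theorem antidiag₃_eq_lit :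
    (Matrix.of fun i j : Fin 3 => if i.val + j.val + 1 = 3 then (1 : ℂ) else 0) = !![(0 : ℂ), 0, 1; 0, 1, 0; 1, 0, 0] := by
  ext i j
  fin_cases i <;> fin_cases j <;> rfl

/-- `T₀ T₀ = 1` for the Sylvester involution `T₀ = 2^{-1∕2}(1,0,1; 0,√2,0; 1,0,−1)`. [folklore] -/
private theorem sylvesterT_mul_self :
    (!![((Real.sqrt 2)⁻¹ : ℂ), 0, ((Real.sqrt 2)⁻¹ : ℂ); 0, 1, 0; ((Real.sqrt 2)⁻¹ : ℂ), 0, -((Real.sqrt 2)⁻¹ : ℂ)] : Matrix (Fin 3) (Fin 3) ℂ) *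
      !![((Real.sqrt 2)⁻¹ : ℂ), 0, ((Real.sqrt 2)⁻¹ : ℂ); 0, 1, 0; ((Real.sqrt 2)⁻¹ : ℂ), 0, -((Real.sqrt 2)⁻¹ : ℂ)] = 1 := by
  have hsq : ((Real.sqrt 2 : ℝ) : ℂ) ^ 2 = 2 := by
    rw [← Complex.ofReal_pow, Real.sq_sqrt (by norm_num : (0 : ℝ) ≤ 2)]
    push_cast
    rfl
  ext i j
  fin_cases i <;> fin_cases j <;> simp [Matrix.mul_apply, Fin.sum_univ_three, ← pow_two, hsq] <;> norm_num

/-- `T₀ᴴ = T₀` (real symmetric). [folklore] -/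
private theorem conjTranspose_sylvesterT :
    (!![((Real.sqrt 2)⁻¹ : ℂ), 0, ((Real.sqrt 2)⁻¹ : ℂ); 0, 1, 0; ((Real.sqrt 2)⁻¹ : ℂ), 0, -((Real.sqrt 2)⁻¹ : ℂ)] : Matrix (Fin 3) (Fin 3) ℂ)ᴴ =
      !![((Real.sqrt 2)⁻¹ : ℂ), 0, ((Real.sqrt 2)⁻¹ : ℂ); 0, 1, 0; ((Real.sqrt 2)⁻¹ : ℂ), 0, -((Real.sqrt 2)⁻¹ : ℂ)] := by
  have hstar : (starRingEnd ℂ) ((Real.sqrt 2)⁻¹ : ℂ) = ((Real.sqrt 2)⁻¹ : ℂ) := by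
    rw [← Complex.ofReal_inv, Complex.conj_ofReal]
  ext i j
  fin_cases i <;> fin_cases j <;> simp [Matrix.conjTranspose, hstar]

/-- `T₀ᴴ Φ₃ T₀ = diag(1,1,−1)` — the Sylvester datum of `Φ₃`. [cite: HornJohnson2013, Thm. 4.5.8] -/
private theorem conjTranspose_sylvesterT_mul_antidiag_mul :
    (!![((Real.sqrt 2)⁻¹ : ℂ), 0, ((Real.sqrt 2)⁻¹ : ℂ); 0, 1, 0; ((Real.sqrt 2)⁻¹ : ℂ), 0, -((Real.sqrt 2)⁻¹ : ℂ)] : Matrix (Fin 3) (Fin 3) ℂ)ᴴ *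
      (Matrix.of fun i j : Fin 3 => if i.val + j.val + 1 = 3 then (1 : ℂ) else 0) *
      !![((Real.sqrt 2)⁻¹ : ℂ), 0, ((Real.sqrt 2)⁻¹ : ℂ); 0, 1, 0; ((Real.sqrt 2)⁻¹ : ℂ), 0, -((Real.sqrt 2)⁻¹ : ℂ)] =
      !![(1 : ℂ), 0, 0; 0, 1, 0; 0, 0, -1] := by
  have hsq : ((Real.sqrt 2 : ℝ) : ℂ) ^ 2 = 2 := by
    rw [← Complex.ofReal_pow, Real.sq_sqrt (by norm_num : (0 : ℝ) ≤ 2)]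
    push_cast
    rfl
  rw [conjTranspose_sylvesterT, antidiag₃_eq_lit]
  ext i j
  fin_cases i <;> fin_cases j <;> simp [Matrix.mul_apply, Fin.sum_univ_three, ← pow_two, hsq] <;> norm_num

/-- `M(u₀,u₁,u₂) = T₀ · diag(u₀,u₁,u₂) · T₀`. [cite: Rogawski1990, §3.6 p. 31] -/
private theorem compactTorusRep₃_eq_sylvesterT_mul_diagonal_mul (u : Fin 3 → ℂ) :
    (!![(u 0 + u 2) / 2, 0, (u 0 - u 2) / 2; 0, u 1, 0; (u 0 - u 2) / 2, 0, (u 0 + u 2) / 2] : Matrix (Fin 3) (Fin 3) ℂ) =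
      !![((Real.sqrt 2)⁻¹ : ℂ), 0, ((Real.sqrt 2)⁻¹ : ℂ); 0, 1, 0; ((Real.sqrt 2)⁻¹ : ℂ), 0, -((Real.sqrt 2)⁻¹ : ℂ)] * Matrix.diagonal u *
        !![((Real.sqrt 2)⁻¹ : ℂ), 0, ((Real.sqrt 2)⁻¹ : ℂ); 0, 1, 0; ((Real.sqrt 2)⁻¹ : ℂ), 0, -((Real.sqrt 2)⁻¹ : ℂ)] := by
  have hsq : ((Real.sqrt 2 : ℝ) : ℂ) ^ 2 = 2 := by
    rw [← Complex.ofReal_pow, Real.sq_sqrt (by norm_num : (0 : ℝ) ≤ 2)]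
    push_cast
    rfl
  have h2 : ((Real.sqrt 2)⁻¹ : ℂ) * ((Real.sqrt 2)⁻¹ : ℂ) = 1 / 2 := by
    rw [← pow_two, inv_pow, hsq]
    norm_num
  ext i j
  fin_cases i <;> fin_cases j <;> simp only [Matrix.mul_apply, Fin.sum_univ_three, Matrix.diagonal_apply] <;> simp <;> ring_nf <;>
    simp only [inv_pow, hsq] <;> ring

/-- `Φ₃` is Hermitian. [cite: Rogawski1990, §1.9 p. 8] -/
private theorem conjTranspose_antidiag₃ :
    (Matrix.of fun i j : Fin 3 => if i.val + j.val + 1 = 3 then (1 : ℂ) else 0)ᴴ = Matrix.of fun i j : Fin 3 => if i.val + j.val + 1 = 3 then (1 : ℂ) else 0 := by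
  ext i j
  fin_cases i <;> fin_cases j <;> simp [Matrix.conjTranspose_apply]

/-- `det Φ₃ = −1`. [cite: Rogawski1990, §1.9 p. 8] -/
private theorem det_antidiag₃ : (Matrix.of fun i j : Fin 3 => if i.val + j.val + 1 = 3 then (1 : ℂ) else 0).det = -1 := by
  rw [Matrix.det_fin_three]
  simp [Matrix.of_apply]

/-- `(M.map conj)ᵀ = Mᴴ`. [folklore] -/
private theorem transpose_map_starRingEnd (M : Matrix (Fin 3) (Fin 3) ℂ) : (M.map (starRingEnd ℂ))ᵀ = Mᴴ := by
  ext i j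
  rfl

/-- **SIGNS OF THREE REALS**: if `q₀ q₁ q₂ < 0` and not all three are negative, then exactly one is negative — recorded as a permutation `σ` of the indices with
`q_{σ 2} < 0 < q_{σ 0}, q_{σ 1}`. [folklore] -/
private theorem exists_perm_neg_last {q : Fin 3 → ℝ} (hprod : q 0 * q 1 * q 2 < 0) (hnot : ¬ (q 0 < 0 ∧ q 1 < 0 ∧ q 2 < 0)) :
    ∃ σ : Equiv.Perm (Fin 3), q (σ 2) < 0 ∧ 0 < q (σ 0) ∧ 0 < q (σ 1) := by
  have h0 : q 0 ≠ 0 := fun h => by rw [h] at hprod; simp at hprod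
  have h1 : q 1 ≠ 0 := fun h => by rw [h] at hprod; simp at hprod
  have h2 : q 2 ≠ 0 := fun h => by rw [h] at hprod; simp at hprod
  rcases lt_or_gt_of_ne h2 with h2n | h2p
  · -- `q₂ < 0`: then `q₀ q₁ > 0`, same sign, not both negative
    have h01 : 0 < q 0 * q 1 := by nlinarith
    rcases lt_or_gt_of_ne h0 with h0n | h0p
    · have h1n : q 1 < 0 := by nlinarith
      exact absurd ⟨h0n, h1n, h2n⟩ hnot
    · exact ⟨1, by simpa using h2n, by simpa using h0p, by simp; nlinarith⟩
  · -- `q₂ > 0`: then `q₀ q₁ < 0`, exactly one of them negative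
    have h01 : q 0 * q 1 < 0 := by nlinarith
    rcases lt_or_gt_of_ne h0 with h0n | h0p
    · refine ⟨Equiv.swap 0 2, ?_, ?_, ?_⟩
      · simpa [Equiv.swap_apply_right] using h0n
      · simpa [Equiv.swap_apply_left] using h2p
      · rw [Equiv.swap_apply_of_ne_of_ne (by decide) (by decide)]; nlinarith
    · refine ⟨Equiv.swap 1 2, ?_, ?_, ?_⟩
      · rw [Equiv.swap_apply_right]; nlinarith
      · rw [Equiv.swap_apply_of_ne_of_ne (by decide) (by decide)]; exact h0p
      · rw [Equiv.swap_apply_left]; exact h2p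

/-- **(α″) RATIONAL NORMAL FORM OF A REGULAR ELLIPTIC ELEMENT OF `U(2,1)`.**  Let `g ∈ U(Φ₃)(ℂ)` have separable characteristic polynomial (three distinct eigenvalues) all
of whose roots are unimodular.  Then there are `h, γ ∈ U(Φ₃)(ℂ)` and pairwise distinct unimodular `u₀, u₁, u₂` with `γ` of matrix `M(u₀,u₁,u₂)` and `g = h γ h⁻¹` IN `U(Φ₃)(ℂ)`
(`u₂` = the eigenvalue on the negative eigenline).  The unimodularity hypothesis is necessary: the split Cartan `diag(λ, u, λ̄⁻¹)`, `|λ| ≠ 1`, has distinct eigenvalues and is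
not conjugate into the compact Cartan. [cite: Rogawski1990, §3.6 p. 31] [cite: Knapp1986, Ch. V §3] [cite: HornJohnson2013, Thm. 1.3.9, Thm. 4.5.8] -/
theorem exists_conj_eq_compactTorusRep₃_of_separable_of_norm_root_eq_one
    {g : GL (Fin 3) ℂ} (hg : g ∈ unitaryGroupOfForm (starRingEnd ℂ) (Matrix.of fun i j : Fin 3 => if i.val + j.val + 1 = 3 then (1 : ℂ) else 0))
    (hsep : (g : Matrix (Fin 3) (Fin 3) ℂ).charpoly.Separable)
    (hunit : ∀ z : ℂ, (g : Matrix (Fin 3) (Fin 3) ℂ).charpoly.IsRoot z → ‖z‖ = 1) :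
    ∃ (h γ : ↥(unitaryGroupOfForm (starRingEnd ℂ) (Matrix.of fun i j : Fin 3 => if i.val + j.val + 1 = 3 then (1 : ℂ) else 0))) (u₀ u₁ u₂ : ℂ),
      ‖u₀‖ = 1 ∧ ‖u₁‖ = 1 ∧ ‖u₂‖ = 1 ∧ u₀ ≠ u₁ ∧ u₀ ≠ u₂ ∧ u₁ ≠ u₂ ∧
      ((γ : GL (Fin 3) ℂ) : Matrix (Fin 3) (Fin 3) ℂ) = !![(u₀ + u₂) / 2, 0, (u₀ - u₂) / 2; 0, u₁, 0; (u₀ - u₂) / 2, 0, (u₀ + u₂) / 2] ∧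
      (⟨g, hg⟩ : ↥(unitaryGroupOfForm (starRingEnd ℂ) (Matrix.of fun i j : Fin 3 => if i.val + j.val + 1 = 3 then (1 : ℂ) else 0))) = h * γ * h⁻¹ := by
  classical
  set Φ : Matrix (Fin 3) (Fin 3) ℂ := Matrix.of fun i j : Fin 3 => if i.val + j.val + 1 = 3 then (1 : ℂ) else 0 with hΦ
  set T₀ : Matrix (Fin 3) (Fin 3) ℂ := !![((Real.sqrt 2)⁻¹ : ℂ), 0, ((Real.sqrt 2)⁻¹ : ℂ); 0, 1, 0; ((Real.sqrt 2)⁻¹ : ℂ), 0, -((Real.sqrt 2)⁻¹ : ℂ)] with hT₀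
  have hΦdet : Φ.det = -1 := det_antidiag₃
  have hΦH : Φᴴ = Φ := conjTranspose_antidiag₃
  -- Step A: diagonalise
  obtain ⟨S, d, hS, hSD, hd⟩ :=
    Literature.LinearAlgebra.Matrix.exists_conj_eq_diagonal_of_nodup_roots' (g : Matrix (Fin 3) (Fin 3) ℂ) (Polynomial.nodup_roots hsep)
  have hdroot : ∀ i, (g : Matrix (Fin 3) (Fin 3) ℂ).charpoly.IsRoot (d i) := fun i => by
    rw [← Polynomial.mem_roots (Matrix.charpoly_monic _).ne_zero, ← hd]
    exact Multiset.mem_map_of_mem _ (Finset.mem_univ_val i)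
  have hdinj : Function.Injective d := by
    intro i j h
    have hnd : (Finset.univ.val.map d).Nodup := by rw [hd]; exact Polynomial.nodup_roots hsep
    exact Multiset.inj_on_of_nodup_map hnd i (Finset.mem_univ_val i) j (Finset.mem_univ_val j) h
  have hu : ∀ i, ‖d i‖ = 1 := fun i => hunit _ (hdroot i)
  have hcu : ∀ i, starRingEnd ℂ (d i) * d i = 1 := fun i => by rw [Complex.conj_mul', hu i]; norm_num
  have hdne : ∀ i, d i ≠ 0 := fun i h => by have := hu i; rw [h, norm_zero] at this; exact zero_ne_one this
  have hgS : (g : Matrix (Fin 3) (Fin 3) ℂ) * S = S * diagonal d := by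
    have h := congrArg (fun M => S * M) hSD
    simpa only [← Matrix.mul_assoc, Matrix.mul_nonsing_inv _ hS, Matrix.one_mul] using h
  have hgJ : ((g : Matrix (Fin 3) (Fin 3) ℂ).map (starRingEnd ℂ))ᵀ * Φ * (g : Matrix (Fin 3) (Fin 3) ℂ) = Φ := hg
  -- Step C: the Gram matrix is diagonal and Hermitian
  set Q : Matrix (Fin 3) (Fin 3) ℂ := (S.map (starRingEnd ℂ))ᵀ * Φ * S with hQ
  have hQ' : Q = Sᴴ * Φ * S := by rw [hQ, transpose_map_starRingEnd]
  have hoff : ∀ i j, i ≠ j → Q i j = 0 := by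
    intro i j hij
    have h0 := sub_one_mul_frameGram_apply_eq_zero (starRingEnd ℂ) hgJ hgS i j
    refine (mul_eq_zero.1 h0).resolve_left (sub_ne_zero.2 fun h1 => hij ?_)
    have hci : starRingEnd ℂ (d i) ≠ 0 := (map_ne_zero _).2 (hdne i)
    exact hdinj (mul_left_cancel₀ hci ((hcu i).trans h1.symm))
  have hQH : Qᴴ = Q := by
    rw [hQ', conjTranspose_mul, conjTranspose_mul, conjTranspose_conjTranspose, hΦH, Matrix.mul_assoc]
  have hQreal : ∀ i, ((Q i i).re : ℂ) = Q i i := fun i => by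
    have h := congrFun (congrFun hQH i) i
    rw [conjTranspose_apply] at h
    exact Complex.conj_eq_iff_re.1 h
  set q : Fin 3 → ℝ := fun i => (Q i i).re with hq
  have hQdiag : Q = diagonal fun i => ((q i : ℝ) : ℂ) := by
    ext i j
    by_cases hij : i = j
    · subst hij; rw [diagonal_apply_eq, hq, hQreal]
    · rw [diagonal_apply_ne _ hij, hoff i j hij]
  -- Step D: `det Q = −|det S|² < 0`, i.e. `q₀ q₁ q₂ < 0`
  have hSdet : S.det ≠ 0 := hS.ne_zero
  have hdetQ : Q.det = -((Complex.normSq S.det : ℝ) : ℂ) := by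
    rw [hQ', det_mul, det_mul, det_conjTranspose, hΦdet, Complex.normSq_eq_conj_mul_self, Complex.star_def]
    ring
  have hprod : q 0 * q 1 * q 2 < 0 := by
    have h1 : Q.det = ((q 0 * q 1 * q 2 : ℝ) : ℂ) := by
      rw [hQdiag, det_diagonal, Fin.prod_univ_three]
      push_cast
      ring
    have h2 : (q 0 * q 1 * q 2 : ℝ) = -Complex.normSq S.det := by
      have := h1.symm.trans hdetQ
      exact_mod_cast this
    rw [h2]
    exact neg_neg_of_pos (Complex.normSq_pos.2 hSdet)
  -- Step E: not all `qᵢ < 0` — the positive vector `e₁`: `1 = (Φ₃)₁₁ = ((S⁻¹)ᴴ Q S⁻¹)₁₁ = Σ qᵢ |(S⁻¹)ᵢ₁|²`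
  have hnot : ¬ (q 0 < 0 ∧ q 1 < 0 ∧ q 2 < 0) := by
    rintro ⟨hq0, hq1, hq2⟩
    have hSS : S * S⁻¹ = 1 := Matrix.mul_nonsing_inv _ hS
    have key : (S⁻¹)ᴴ * Q * S⁻¹ = Φ := by
      rw [hQ']
      calc (S⁻¹)ᴴ * (Sᴴ * Φ * S) * S⁻¹ = (S * S⁻¹)ᴴ * Φ * (S * S⁻¹) := by rw [conjTranspose_mul]; simp only [Matrix.mul_assoc]
        _ = Φ := by rw [hSS, conjTranspose_one, Matrix.one_mul, Matrix.mul_one]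
    have h11 : ((S⁻¹)ᴴ * Q * S⁻¹) 1 1 = ∑ i : Fin 3, ((q i : ℝ) : ℂ) * ((‖S⁻¹ i 1‖ ^ 2 : ℝ) : ℂ) := by
      rw [hQdiag, Matrix.mul_apply]
      refine Finset.sum_congr rfl fun i _ => ?_
      rw [Matrix.mul_apply, Finset.sum_eq_single i (fun k _ hk => by rw [diagonal_apply_ne _ hk, mul_zero]) (fun h => absurd (Finset.mem_univ i) h),
        conjTranspose_apply, diagonal_apply_eq, Complex.star_def]
      have : starRingEnd ℂ (S⁻¹ i 1) * S⁻¹ i 1 = ((‖S⁻¹ i 1‖ ^ 2 : ℝ) : ℂ) := by rw [Complex.conj_mul']; push_cast; ring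
      calc starRingEnd ℂ (S⁻¹ i 1) * ((q i : ℝ) : ℂ) * S⁻¹ i 1 = ((q i : ℝ) : ℂ) * (starRingEnd ℂ (S⁻¹ i 1) * S⁻¹ i 1) := by ring
        _ = ((q i : ℝ) : ℂ) * ((‖S⁻¹ i 1‖ ^ 2 : ℝ) : ℂ) := by rw [this]
    have hΦ11 : Φ 1 1 = 1 := rfl
    have h1 : (1 : ℂ) = ∑ i : Fin 3, ((q i : ℝ) : ℂ) * ((‖S⁻¹ i 1‖ ^ 2 : ℝ) : ℂ) := by rw [← h11, key, hΦ11]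
    have h1' : (1 : ℝ) = ∑ i : Fin 3, q i * ‖S⁻¹ i 1‖ ^ 2 := by exact_mod_cast h1
    have hle : ∑ i : Fin 3, q i * ‖S⁻¹ i 1‖ ^ 2 ≤ 0 := by
      rw [Fin.sum_univ_three]
      nlinarith [sq_nonneg ‖S⁻¹ 0 1‖, sq_nonneg ‖S⁻¹ 1 1‖, sq_nonneg ‖S⁻¹ 2 1‖]
    linarith
  -- Step F: the negative index last
  obtain ⟨σ, hσ2, hσ0, hσ1⟩ := exists_perm_neg_last hprod hnot
  -- Step G: the renormalised frame `S′ = S E`, `E_{a i} = [a = σ i] rᵢ`, `rᵢ = |q_{σ i}|^{-1∕2}`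
  set r : Fin 3 → ℝ := fun i => (Real.sqrt |q (σ i)|)⁻¹ with hr
  have hqne : ∀ i, q (σ i) ≠ 0 := by
    intro i; fin_cases i
    · exact hσ0.ne'
    · exact hσ1.ne'
    · exact hσ2.ne
  have hrabs : ∀ i, r i * r i * |q (σ i)| = 1 := by
    intro i
    have hpos : 0 < |q (σ i)| := abs_pos.2 (hqne i)
    show (Real.sqrt |q (σ i)|)⁻¹ * (Real.sqrt |q (σ i)|)⁻¹ * |q (σ i)| = 1
    rw [← mul_inv, Real.mul_self_sqrt hpos.le, inv_mul_cancel₀ hpos.ne']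
  have hrr0 : r 0 * r 0 * q (σ 0) = 1 := by have h := hrabs 0; rwa [abs_of_pos hσ0] at h
  have hrr1 : r 1 * r 1 * q (σ 1) = 1 := by have h := hrabs 1; rwa [abs_of_pos hσ1] at h
  have hrr2 : r 2 * r 2 * q (σ 2) = -1 := by have h := hrabs 2; rw [abs_of_neg hσ2] at h; linarith
  have hrq : ∀ i, ((r i : ℝ) : ℂ) * ((q (σ i) : ℝ) : ℂ) * ((r i : ℝ) : ℂ) = (![(1 : ℂ), 1, -1] : Fin 3 → ℂ) i := by
    intro i
    fin_cases i
    · have e := congrArg (fun x : ℝ => (x : ℂ)) hrr0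
      push_cast at e
      simp only [Fin.zero_eta, Fin.isValue, cons_val_zero]
      linear_combination e
    · have e := congrArg (fun x : ℝ => (x : ℂ)) hrr1
      push_cast at e
      simp only [Fin.mk_one, Fin.isValue, cons_val_one, cons_val_zero]
      linear_combination e
    · have e := congrArg (fun x : ℝ => (x : ℂ)) hrr2
      push_cast at e
      simp only [Fin.reduceFinMk, Fin.isValue, cons_val]
      linear_combination e
  set E : Matrix (Fin 3) (Fin 3) ℂ := Matrix.of fun a i => if a = σ i then ((r i : ℝ) : ℂ) else 0 with hE
  set S' : Matrix (Fin 3) (Fin 3) ℂ := S * E with hS'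
  -- `Eᴴ Q E = diag(1,1,−1)`
  have hEv : ∀ b i, E b i = if b = σ i then ((r i : ℝ) : ℂ) else 0 := fun b i => by rw [hE, Matrix.of_apply]
  have hEQE : Eᴴ * Q * E = diagonal ![(1 : ℂ), 1, -1] := by
    rw [hQdiag]
    ext i j
    rw [Matrix.mul_apply]
    have inner : ∀ b, (Eᴴ * diagonal fun i => ((q i : ℝ) : ℂ)) i b = (starRingEnd ℂ) (E b i) * ((q b : ℝ) : ℂ) := by
      intro b
      rw [Matrix.mul_apply, Finset.sum_eq_single b (fun k _ hk => by rw [diagonal_apply_ne _ hk, mul_zero]) (fun h => absurd (Finset.mem_univ b) h),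
        conjTranspose_apply, diagonal_apply_eq, Complex.star_def]
    simp_rw [inner]
    rw [Finset.sum_eq_single (σ i) (fun b _ hb => by rw [hEv b i, if_neg hb, map_zero, zero_mul, zero_mul]) (fun h => absurd (Finset.mem_univ _) h),
      hEv, hEv, if_pos rfl, Complex.conj_ofReal]
    by_cases hij : i = j
    · subst hij
      rw [if_pos rfl, diagonal_apply_eq, ← hrq i]
    · have hne : σ i ≠ σ j := fun h => hij (σ.injective h)
      rw [if_neg hne, mul_zero, diagonal_apply_ne _ hij]
  have hS'gram : S'ᴴ * Φ * S' = diagonal ![(1 : ℂ), 1, -1] := by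
    rw [hS', conjTranspose_mul]
    calc Eᴴ * Sᴴ * Φ * (S * E) = Eᴴ * (Sᴴ * Φ * S) * E := by simp only [Matrix.mul_assoc]
      _ = diagonal ![(1 : ℂ), 1, -1] := by rw [← hQ', hEQE]
  -- `diag(d) E = E diag(d ∘ σ)`, hence `g S′ = S′ diag(u)`
  set u : Fin 3 → ℂ := fun i => d (σ i) with hudef
  have hdE : diagonal d * E = E * diagonal u := by
    ext a i
    rw [diagonal_mul, mul_diagonal, hE, Matrix.of_apply]
    split_ifs with h
    · subst h; rw [mul_comm]
    · rw [mul_zero, zero_mul]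
  have hgS' : (g : Matrix (Fin 3) (Fin 3) ℂ) * S' = S' * diagonal u := by
    rw [hS', ← Matrix.mul_assoc, hgS, Matrix.mul_assoc, hdE, Matrix.mul_assoc]
  -- Step H: `h = S′ T₀`
  set hm : Matrix (Fin 3) (Fin 3) ℂ := S' * T₀ with hhm
  have hT₀T₀ : T₀ * T₀ = 1 := sylvesterT_mul_self
  have hT₀H : T₀ᴴ = T₀ := conjTranspose_sylvesterT
  have hhmem : hmᴴ * Φ * hm = Φ := by
    rw [hhm, conjTranspose_mul]
    calc T₀ᴴ * S'ᴴ * Φ * (S' * T₀) = T₀ᴴ * (S'ᴴ * Φ * S') * T₀ := by simp only [Matrix.mul_assoc]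
      _ = T₀ᴴ * diagonal ![(1 : ℂ), 1, -1] * T₀ := by rw [hS'gram]
      _ = Φ := by
        have h := conjTranspose_sylvesterT_mul_antidiag_mul
        -- `T₀ᴴ Φ T₀ = D` with `T₀² = 1`, `T₀ᴴ = T₀` gives `T₀ᴴ D T₀ = Φ`
        rw [hT₀H] at h ⊢
        have hD : (!![(1 : ℂ), 0, 0; 0, 1, 0; 0, 0, -1] : Matrix (Fin 3) (Fin 3) ℂ) = diagonal ![(1 : ℂ), 1, -1] := by
          ext i j; fin_cases i <;> fin_cases j <;> simp [diagonal]
        rw [← hD, ← h]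
        calc T₀ * (T₀ * Φ * T₀) * T₀ = (T₀ * T₀) * Φ * (T₀ * T₀) := by simp only [Matrix.mul_assoc]
          _ = Φ := by rw [hT₀T₀, Matrix.one_mul, Matrix.mul_one]
  have hMu : (!![(u 0 + u 2) / 2, 0, (u 0 - u 2) / 2; 0, u 1, 0; (u 0 - u 2) / 2, 0, (u 0 + u 2) / 2] : Matrix (Fin 3) (Fin 3) ℂ) = T₀ * diagonal u * T₀ :=
    compactTorusRep₃_eq_sylvesterT_mul_diagonal_mul u
  have hconjm : (g : Matrix (Fin 3) (Fin 3) ℂ) * hm = hm * !![(u 0 + u 2) / 2, 0, (u 0 - u 2) / 2; 0, u 1, 0; (u 0 - u 2) / 2, 0, (u 0 + u 2) / 2] := by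
    rw [hMu, hhm, ← Matrix.mul_assoc, hgS']
    calc S' * diagonal u * T₀ = S' * (T₀ * T₀) * diagonal u * T₀ := by rw [hT₀T₀, Matrix.mul_one]
      _ = S' * T₀ * (T₀ * diagonal u * T₀) := by simp only [Matrix.mul_assoc]
  -- the units
  have hhdet : hm.det ≠ 0 := by
    intro h0
    have h := congrArg Matrix.det hhmem
    rw [det_mul, det_mul, det_conjTranspose, h0, hΦdet] at h
    norm_num at h
  set hU : GL (Fin 3) ℂ := Matrix.nonsingInvUnit hm (isUnit_iff_ne_zero.2 hhdet) with hhU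
  have hhUval : ((hU : GL (Fin 3) ℂ) : Matrix (Fin 3) (Fin 3) ℂ) = hm := rfl
  have hhUmem : hU ∈ unitaryGroupOfForm (starRingEnd ℂ) Φ := by
    rw [mem_unitaryGroupOfForm_iff, hhUval, transpose_map_starRingEnd]
    exact hhmem
  have hcu' : ∀ i, starRingEnd ℂ (u i) * u i = 1 := fun i => hcu (σ i)
  set γU : GL (Fin 3) ℂ :=
    ⟨!![(u 0 + u 2) / 2, 0, (u 0 - u 2) / 2; 0, u 1, 0; (u 0 - u 2) / 2, 0, (u 0 + u 2) / 2],
      !![((u 0)⁻¹ + (u 2)⁻¹) / 2, 0, ((u 0)⁻¹ - (u 2)⁻¹) / 2; 0, (u 1)⁻¹, 0; ((u 0)⁻¹ - (u 2)⁻¹) / 2, 0, ((u 0)⁻¹ + (u 2)⁻¹) / 2],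
      by rw [compactTorusRep₃_mul, mul_inv_cancel₀ (hdne _), mul_inv_cancel₀ (hdne _), mul_inv_cancel₀ (hdne _)]; exact compactTorusRep₃_one,
      by rw [compactTorusRep₃_mul, inv_mul_cancel₀ (hdne _), inv_mul_cancel₀ (hdne _), inv_mul_cancel₀ (hdne _)]; exact compactTorusRep₃_one⟩ with hγU
  have hγUval : ((γU : GL (Fin 3) ℂ) : Matrix (Fin 3) (Fin 3) ℂ) = !![(u 0 + u 2) / 2, 0, (u 0 - u 2) / 2; 0, u 1, 0; (u 0 - u 2) / 2, 0, (u 0 + u 2) / 2] := rfl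
  have hγUmem : γU ∈ unitaryGroupOfForm (starRingEnd ℂ) Φ := by
    rw [mem_unitaryGroupOfForm_iff, hγUval, hΦ]
    exact conjTranspose_compactTorusRep₃_mul (hcu' 0) (hcu' 1) (hcu' 2)
  refine ⟨⟨hU, hhUmem⟩, ⟨γU, hγUmem⟩, u 0, u 1, u 2, hu _, hu _, hu _,
    fun h => by have := hdinj h; exact absurd (σ.injective this) (by decide),
    fun h => by have := hdinj h; exact absurd (σ.injective this) (by decide),
    fun h => by have := hdinj h; exact absurd (σ.injective this) (by decide), hγUval, ?_⟩
  rw [eq_mul_inv_iff_mul_eq]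
  apply Subtype.ext
  apply Units.ext
  show (g : Matrix (Fin 3) (Fin 3) ℂ) * hm = hm * !![(u 0 + u 2) / 2, 0, (u 0 - u 2) / 2; 0, u 1, 0; (u 0 - u 2) / 2, 0, (u 0 + u 2) / 2]
  exact hconjm

/-- **(Z′) ∘ (α″): every regular elliptic element of `U(2,1)` has compact centraliser.**  For `g ∈ U(Φ₃)(ℂ)` with separable characteristic polynomial and unimodular
eigenvalues, `Z(g)` is a compact space (the `[CompactSpace ↥Z(γ)]` token of the (VOL) assembler at an actual class). [cite: Knapp1986, Ch. V §3] [cite: Rogawski1990, §3.6 p. 31] -/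
theorem compactSpace_centralizer_of_separable_of_norm_root_eq_one
    {g : GL (Fin 3) ℂ} (hg : g ∈ unitaryGroupOfForm (starRingEnd ℂ) (Matrix.of fun i j : Fin 3 => if i.val + j.val + 1 = 3 then (1 : ℂ) else 0))
    (hsep : (g : Matrix (Fin 3) (Fin 3) ℂ).charpoly.Separable)
    (hunit : ∀ z : ℂ, (g : Matrix (Fin 3) (Fin 3) ℂ).charpoly.IsRoot z → ‖z‖ = 1) :
    CompactSpace ↥(Subgroup.centralizer
      ({(⟨g, hg⟩ : ↥(unitaryGroupOfForm (starRingEnd ℂ) (Matrix.of fun i j : Fin 3 => if i.val + j.val + 1 = 3 then (1 : ℂ) else 0)))} :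
        Set ↥(unitaryGroupOfForm (starRingEnd ℂ) (Matrix.of fun i j : Fin 3 => if i.val + j.val + 1 = 3 then (1 : ℂ) else 0)))) := by
  obtain ⟨h, γ, u₀, u₁, u₂, h₀, h₁, h₂, -, h₀₂, h₁₂, hγ, hconj⟩ := exists_conj_eq_compactTorusRep₃_of_separable_of_norm_root_eq_one hg hsep hunit
  exact compactSpace_centralizer_of_eq_conj_compactTorusRep₃ le_rfl isClosed_unitaryGroupOfForm_antidiag_three h₀ h₁ h₂ h₀₂ h₁₂ hγ hconj

end NormalForm

end Literature.NumberTheory.Rogawski1990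

end
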